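import Summits.QuantumFields.YangMills.Theorems.BalabanLadderIRColdDefectCouplingSign
import Summits.QuantumFields.YangMills.Theorems.BalabanLadderIRColdPurityQuarterDoorSU2
import Literature.MathematicalPhysics.QuantumLattice.RepLieAlgebraUnitary
import Literature.Analysis.FunctionSpaces.BesselMoments
import HarnessLib

/-!
# Sketch — crux idea `spectral-tilt` on `BalabanLadder.IRcof` (stmt-QuantumFields-26930), lens oqh, ideator ym-ir-idea-30 g2

First-lemma signatures only (Props, no `sorry`), plus one by-name composition with the LEAD's p685221 dictionary
`CouplingAxis.Sign.monotoneOn_coldDefect_of_actionDefect_nonneg` (MONO⁺).  Instrument-side; width 0 toward PXcof ∕ IRcof.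
HONEST: nothing here proves IRcof, IR, PX(1/24), PXcof(1/24) or the Yang–Mills mass gap.
-/

noncomputable section

open Set Filter Topology
open Literature.MathematicalPhysics.QuantumFieldTheory Literature.MathematicalPhysics.QuantumLattice
open Literature.Analysis.FunctionSpaces (besselI)
open Summit.QuantumFields.YangMills.Cruxes.IR.ColdPurityBridge (coldDefect)
open Summit.QuantumFields.YangMills.Cruxes.IR.CouplingAxis.Sign (monotoneOn_coldDefect_of_actionDefect_nonneg)

namespace Summit.QuantumFields.YangMills.Cruxes.IRcof.SpectralTilt

/-- The action-additivity defect under time doubling for the `SU(2)` fundamental Wilson theory,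
`A_β(L) := ⟨S⟩_{β; L³×2⌊L/4⌋} − 2⟨S⟩_{β; L³×⌊L/4⌋}` (tree coupling `β`, `β_W = 2β`), spelled exactly as the hypothesis
`hA` of `CouplingAxis.Sign.monotoneOn_coldDefect_of_actionDefect_nonneg`. -/
def actionDefectSU2 (β : ℝ) (L : ℕ) : ℝ :=
  finTorusExpectation (fundamentalLatticeRep 2).ρ β
      (finTorusWilsonAction (n₀ := L) (n₁ := L) (n₂ := L) (n₃ := 2 * (L / 4)) (fundamentalLatticeRep 2).ρ) -
    2 * finTorusExpectation (fundamentalLatticeRep 2).ρ β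
      (finTorusWilsonAction (n₀ := L) (n₁ := L) (n₂ := L) (n₃ := L / 4) (fundamentalLatticeRep 2).ρ)

/-- **FIRST LEMMA (a-SC) — strong-coupling sign of the action defect, UNIFORM in the box.**
There is `β₁ > 0` such that for every side `L ≥ 8` and every tree coupling `β ∈ [0, β₁]`, `0 ≤ A_β(L)`.
(Mechanism: time-wrapping flux-tube sector of the finite-size character ∕ polymer expansion,
`F_β(L) = −log(Z_{2t}/Z_t²) = 6L³u^{4t} − 3L³u^{8t} + …`, `u = I₂(2β)/I₁(2β)`, with the tube decorations exponentiated into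
the strong-coupling glueball mass `m(u) = −4 log u + 2u² − …`, `m'(β) < 0`; the uniformity in `L` is the content.) -/
def StrongCouplingSignSU2 : Prop :=
  ∃ β₁ : ℝ, 0 < β₁ ∧ ∀ L : ℕ, 8 ≤ L → ∀ β ∈ Icc (0 : ℝ) β₁, 0 ≤ actionDefectSU2 β L

/-- BY-NAME COMPOSITION with the LEAD's MONO⁺ (`CouplingAxis.Sign.monotoneOn_coldDefect_of_actionDefect_nonneg`):
the strong-coupling sign makes `β ↦ δᶜ_β(L)` non-decreasing on `[0, β₁]` for every `L ≥ 8` (so the `1/24`-pure couplings of the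
box form an initial segment there, `coldDefect_le_of_le_of_actionDefect_nonneg`). -/
theorem monotoneOn_coldDefect_of_strongCouplingSign (h : StrongCouplingSignSU2) :
    ∃ β₁ : ℝ, 0 < β₁ ∧ ∀ L : ℕ, 8 ≤ L →
      MonotoneOn (fun β : ℝ => coldDefect (fundamentalLatticeRep 2).ρ β L) (Icc (0 : ℝ) β₁) := by
  obtain ⟨β₁, hβ₁, hA⟩ := h
  exact ⟨β₁, hβ₁, fun L hL =>
    monotoneOn_coldDefect_of_actionDefect_nonneg (fundamentalLatticeRep 2) L (convex_Icc 0 β₁) (hA L hL)⟩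

/-- **SPECTRAL TILT LEMMA (pure analysis; the structural lever).**  For two families of transfer-matrix eigenvalue
ratios `r ≤ r'` pointwise in `[0,1]` (vacuum index `i₀`, `r i₀ = r' i₀ = 1`) with thermal traces
`1 + x_T = Σᵢ rᵢ^T` at `T = t, 2t`, the purity ratio `(1 + x_{2t})/(1 + x_t)²` is SMALLER for the dominating family,
provided the cold side condition `r'ᵢ^t (1 + x'_t) ≤ 1` (`i ≠ i₀`).  (Gradient of `Φ(r) = (1+Σr^{2t})/(1+Σr^t)²`:
`∂ⱼΦ ∝ rⱼ^{t-1}(rⱼ^t(1+x_t) − (1+x_{2t})) ≤ 0` on the cold region.)  With the tree's spectral bookkeeping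
`DoublingDefect.exists_ratios_hasSum_traceExcess` (`Z_β(N³×T) = λ₊^T Σ rᵢ^T`) this turns GAP CONTRACTION in the coupling
(every ratio `λᵢ/λ₊` non-decreasing in `β`) into MONO⁺ without differentiating eigenvalues. -/
def TiltLemma : Prop :=
  ∀ (ι : Type) [DecidableEq ι] (i₀ : ι) (t : ℕ), 1 ≤ t →
    ∀ r r' : ι → ℝ, (∀ i, 0 ≤ r i) → (∀ i, r i ≤ r' i) → (∀ i, r' i ≤ 1) → r i₀ = 1 → r' i₀ = 1 →
    ∀ x₁ x₂ x₁' x₂' : ℝ,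
      HasSum (Function.update (fun i => r i ^ t) i₀ 0) x₁ →
      HasSum (Function.update (fun i => r i ^ (2 * t)) i₀ 0) x₂ →
      HasSum (Function.update (fun i => r' i ^ t) i₀ 0) x₁' →
      HasSum (Function.update (fun i => r' i ^ (2 * t)) i₀ 0) x₂' →
      (∀ i, i ≠ i₀ → r' i ^ t * (1 + x₁') ≤ 1) →
      (1 + x₂') / (1 + x₁') ^ 2 ≤ (1 + x₂) / (1 + x₁) ^ 2

/-- **GAP DOMINATION ⇒ MONO⁺ (the typed target the tilt lemma serves), `SU(2)`, one box.**  On a set `D` of couplings: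
if for `β ≤ β'` in `D` the cold tori `L³×⌊L/4⌋`, `L³×2⌊L/4⌋` admit spectral data on a common index with pointwise
dominated ratios and the cold side condition at `β'`, then `δᶜ_β(L) ≤ δᶜ_{β'}(L)`.  Stated with the partition functions and
`transferSpectralRadius` exactly as in `exists_ratios_hasSum_traceExcess`. -/
def GapDominationMono (L : ℕ) [NeZero L] (D : Set ℝ) : Prop :=
  (∀ β ∈ D, ∀ β' ∈ D, β ≤ β' →
    ∃ (ι : Type) (_ : DecidableEq ι) (i₀ : ι) (r r' : ι → ℝ),
      (∀ i, 0 ≤ r i) ∧ (∀ i, r i ≤ r' i) ∧ (∀ i, r' i ≤ 1) ∧ r i₀ = 1 ∧ r' i₀ = 1 ∧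
      (∀ T ∈ ({L / 4, 2 * (L / 4)} : Set ℕ),
        HasSum (fun i => r i ^ T)
          (wilsonFinTorusPartition (fundamentalLatticeRep 2).ρ β L L L T /
            transferSpectralRadius (fundamentalLatticeRep 2).ρ β L ^ T) ∧
        HasSum (fun i => r' i ^ T)
          (wilsonFinTorusPartition (fundamentalLatticeRep 2).ρ β' L L L T /
            transferSpectralRadius (fundamentalLatticeRep 2).ρ β' L ^ T)) ∧
      (∀ i, i ≠ i₀ → r' i ^ (L / 4) *
        (wilsonFinTorusPartition (fundamentalLatticeRep 2).ρ β' L L L (L / 4) /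
          transferSpectralRadius (fundamentalLatticeRep 2).ρ β' L ^ (L / 4)) ≤ 1)) →
  MonotoneOn (fun β : ℝ => coldDefect (fundamentalLatticeRep 2).ρ β L) D

/-- **TUBE CERTIFICATE at the instrument box `L = 8` (`t = 2`) — shape of deliverable (b).**  The cold defect of the
`8³×(2,4)` pair is the wrapping-tube term `6·8³·u⁸` up to a remainder of relative order `u²` on an initial coupling segment:
`|δᶜ_β(8) − 3072·u(β)⁸| ≤ R·u(β)^{10}` for `β ∈ [0, β₁]`, `u(β) = I₂(2β)/I₁(2β)`.  (True near `0` by analyticity; the NUMBER —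
how large `β₁` can be certified with which `R` — is the eng ∕ prover content, cf. the E2-TUBE ask.) -/
def TubeCertificate8 : Prop :=
  ∃ β₁ R : ℝ, 0 < β₁ ∧ 0 ≤ R ∧ ∀ β ∈ Icc (0 : ℝ) β₁,
    |coldDefect (fundamentalLatticeRep 2).ρ β 8 -
        3072 * (besselI 2 (2 * β) / besselI 1 (2 * β)) ^ 8| ≤
      R * (besselI 2 (2 * β) / besselI 1 (2 * β)) ^ 10

end Summit.QuantumFields.YangMills.Cruxes.IRcof.SpectralTilt

end
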